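import Literature.MathematicalPhysics.QuantumManyBody.PeriodicBoseGasLemma24Facts
import Literature.MathematicalPhysics.QuantumManyBody.PeriodicBoseGasCoulombFourier
import Literature.MathematicalPhysics.QuantumManyBody.PeriodicBoseGasScatteringNewton
import HarnessLib

/-!
# Fournais 2020, (2.42) with (A.6): the Coulomb energy of `W₁`, proved

Topic `Literature/MathematicalPhysics/QuantumManyBody` (provefact
`Literature.MathematicalPhysics.QuantumManyBody.BoseGas.Fournais2020_condensation`, layer `Fournais2020_lemma24`).
This file discharges the named fact `Fournais2020_eq242` (`PeriodicBoseGasLemma24Facts.lean`), one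
of the three inputs of `Fournais2020_lemma24_of_facts` (`PeriodicBoseGasLemma24.lean`):
`theorem Fournais2020_eq242_holds : Fournais2020_eq242`, i.e.
`∫|𝓕W₁(p)|²/(8π²|p|²)dp ≤ (1 + 2C(R/ℓ)²)² ∫gω`. The printed chain [Fournais2020, (2.42)]
"`(2π)⁻³∫Ŵ₁²/(2p²) = ∬W₁(x)W₁(y)/(2|x-y|) ≤ (1+C(R/ℓ)²)(2π)⁻³∫ĝ²/(2p²) = (1+C(R/ℓ)²)∫gω`, where
we used (A.6)" is rendered by the two sibling files:

* `lintegral_normSq_fourier_div_eq` (`PeriodicBoseGasCoulombFourier.lean`): the Coulomb energy in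
  momentum space equals the position-space double integral, in `[0, ∞]`, for the merely integrable
  `W₁ ≥ 0` (Gaussian subordination; no Plancherel);
* `0 ≤ W₁ ≤ (1 + 2C(R/ℓ)²)g` pointwise (`bigW₁_le_sharp`, here in real form `toReal_bigW₁_le_sharp`)
  and positivity of the kernel `|x-y|⁻¹` give the comparison of the double integrals (the factor
  enters squared, the energy being quadratic);
* `IsScatteringSolution.ae_eq_potential` (`PeriodicBoseGasScatteringNewton.lean`):
  `ω = (8π)⁻¹∫g(y)/|x-y|dy` a.e., the position-space form of (A.6) `ω̂(k) = ĝ(k)/(2k²)`, whence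
  `(8π)⁻¹∬g(x)g(y)/|x-y| = ∫gω` (Tonelli; `≤` where `v = ∞`, a null set).

No new definitions.

## References

* [Fournais2020] S. Fournais, *Length scales for BEC in the dilute Bose gas*, arXiv:2011.00309,
  EMS Ser. Congr. Rep. 18 (2021), doi:10.4171/ecr/18-1/7: (2.42), App. A (A.4)–(A.6).
-/

noncomputable section

open MeasureTheory Set Filter
open scoped ENNReal NNReal FourierTransform

namespace Literature.MathematicalPhysics.QuantumManyBody.BoseGas

variable {v : ℝ → ℝ≥0∞} {ω : Space → ℝ} {χ : Space → ℝ} {ℓ C R : ℝ}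

/-- **`W₁ ≤ (1 + 2C(R/ℓ)²) g` in real numbers** (`g = v(1-ω)`; where `v = ∞` both sides vanish).
[cite: Fournais2020, the bound before (2.42)] -/
theorem toReal_bigW₁_le_sharp (hR : ∀ r, R < r → v r = 0) (hℓ : 0 < ℓ) (hC : 0 ≤ C)
    (hχC : ∀ y : Space, 1 - C * ‖y‖ ^ 2 ≤ selfConv χ y) (hsmall : C * (R / ℓ) ^ 2 ≤ 1 / 2)
    (hω : IsScatteringSolution v ω) (x : Space) :
    (bigW₁ v ω χ ℓ x).toReal ≤ (1 + 2 * C * (R / ℓ) ^ 2) * ((v ‖x‖).toReal * (1 - ω x)) := by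
  have hle := bigW₁_le_sharp (ω := ω) (χ := χ) hR hℓ hC hχC hsmall x
  have hlam : 0 ≤ 1 + 2 * C * (R / ℓ) ^ 2 := by positivity
  have h1ω : 0 ≤ 1 - ω x := by linarith [hω.le_one x]
  by_cases htop : bigW₁ v ω χ ℓ x = ⊤
  · rw [htop, ENNReal.toReal_top]
    exact mul_nonneg hlam (mul_nonneg ENNReal.toReal_nonneg h1ω)
  · have hvt : v ‖x‖ * ENNReal.ofReal (1 - ω x) ≠ ⊤ := by
      intro h
      apply htop
      unfold bigW₁
      rw [h, ENNReal.top_div_of_ne_top ENNReal.ofReal_ne_top]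
    have h2 := ENNReal.toReal_mono (ENNReal.mul_ne_top ENNReal.ofReal_ne_top hvt) hle
    rwa [ENNReal.toReal_mul, ENNReal.toReal_ofReal hlam, ENNReal.toReal_mul, ENNReal.toReal_ofReal h1ω] at h2

/-- `ofReal(g ω) ≤ v · ofReal((1-ω)ω)` pointwise (`g = v(1-ω)` in real numbers; equality unless
`v = ∞`). [cite: Fournais2020, (2.10), (A.4)] -/
theorem ofReal_scatteringDensity_mul_le (v : ℝ → ℝ≥0∞) (ω : Space → ℝ) (x : Space) :
    ENNReal.ofReal ((v ‖x‖).toReal * (1 - ω x) * ω x) ≤ v ‖x‖ * ENNReal.ofReal ((1 - ω x) * ω x) := by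
  by_cases htop : v ‖x‖ = ⊤
  · rw [htop, ENNReal.toReal_top, zero_mul, zero_mul, ENNReal.ofReal_zero]
    exact bot_le
  · rw [mul_assoc, ENNReal.ofReal_mul ENNReal.toReal_nonneg, ENNReal.ofReal_toReal htop]

/-- **Fournais 2020, (2.42) with (A.6), proved**: `∫|𝓕W₁(p)|²/(8π²|p|²)dp ≤ (1 + 2C(R/ℓ)²)²∫gω`.
The printed chain: `(2π)⁻³∫Ŵ₁²/(2p²) = ∬W₁(x)W₁(y)/(2|x-y|)` (here: the Coulomb energy in momentum
space by Gaussian subordination, `lintegral_normSq_fourier_div_eq`, valid in `[0,∞]` for the merely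
integrable `W₁ ≥ 0`), `≤ (1 + C(R/ℓ)²)²∬g(x)g(y)/(2|x-y|)` (pointwise `0 ≤ W₁ ≤ (1 + 2C(R/ℓ)²)g`, the
kernel being positive), `= (1 + C(R/ℓ)²)²∫gω` "where we used (A.6)" (`ω = (8π)⁻¹∫g(y)/|x-y|dy` a.e.,
`IsScatteringSolution.ae_eq_potential`). [cite: Fournais2020, (2.42), App. A (A.6)] -/
theorem Fournais2020_eq242_holds : Fournais2020_eq242 := by
  intro v hv hvi ω hω χ hχ C R hC hχC hR0 hR ℓ hℓ hsmall
  have hvm : Measurable v := hv.1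
  -- the players
  set lam : ℝ := 1 + 2 * C * (R / ℓ) ^ 2 with hlam
  have hlam0 : 0 ≤ lam := by positivity
  set f : Space → ℝ := fun x => (bigW₁ v ω χ ℓ x).toReal with hfdef
  set g : Space → ℝ := fun y => (v ‖y‖).toReal * (1 - ω y) with hgdef
  have hf0 : ∀ x, 0 ≤ f x := fun x => ENNReal.toReal_nonneg
  have hfm : Measurable f := (measurable_bigW₁ hvm hω.measurable hχ ℓ).ennreal_toReal
  have hfi : Integrable f := (integral_toReal_bigW₁_le_sharp hvm hR hvi hℓ hC hχ hχC hsmall hω).1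
  have hfg : ∀ x, f x ≤ lam * g x := fun x => toReal_bigW₁_le_sharp hR hℓ hC hχC hsmall hω x
  have hgm : Measurable g := measurable_scatteringDensity hvm hω
  have hgi : Integrable g := integrable_scatteringDensity hvm hvi hω
  have hg0 : ∀ y, 0 ≤ g y := scatteringDensity_nonneg hω
  -- Step 1: the left-hand side is half the Coulomb energy of `W₁`
  have step1 : ∫⁻ p : Space, ENNReal.ofReal (‖𝓕 (fun x : Space => ((bigW₁ v ω χ ℓ x).toReal : ℂ)) p‖ ^ 2 /
      (8 * Real.pi ^ 2 * ‖p‖ ^ 2)) =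
      ENNReal.ofReal 2⁻¹ * ∫⁻ x, ∫⁻ y, ENNReal.ofReal (f x * f y * (4 * Real.pi * ‖x - y‖)⁻¹) := by
    rw [← lintegral_normSq_fourier_div_eq hfm hfi hf0, ← lintegral_const_mul' _ _ ENNReal.ofReal_ne_top]
    refine lintegral_congr fun p => ?_
    rw [← ENNReal.ofReal_mul (by norm_num)]
    congr 1
    simp only [hfdef]
    rw [div_eq_mul_inv]
    by_cases hp : ‖p‖ = 0
    · simp [hp]
    · field_simp
      ring
  -- Step 2: compare the Coulomb energies pointwise
  have step2 : ∫⁻ x, ∫⁻ y, ENNReal.ofReal (f x * f y * (4 * Real.pi * ‖x - y‖)⁻¹) ≤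
      ENNReal.ofReal (lam ^ 2) * ∫⁻ x, ∫⁻ y, ENNReal.ofReal (g x * g y * (4 * Real.pi * ‖x - y‖)⁻¹) := by
    rw [← lintegral_const_mul' _ _ ENNReal.ofReal_ne_top]
    refine lintegral_mono fun x => ?_
    rw [← lintegral_const_mul' _ _ ENNReal.ofReal_ne_top]
    refine lintegral_mono fun y => ?_
    rw [← ENNReal.ofReal_mul (sq_nonneg _)]
    refine ENNReal.ofReal_le_ofReal ?_
    have hk : 0 ≤ (4 * Real.pi * ‖x - y‖)⁻¹ := by positivity
    calc f x * f y * (4 * Real.pi * ‖x - y‖)⁻¹ ≤ (lam * g x) * (lam * g y) * (4 * Real.pi * ‖x - y‖)⁻¹ :=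
          mul_le_mul_of_nonneg_right (mul_le_mul (hfg x) (hfg y) (hf0 y) (mul_nonneg hlam0 (hg0 x))) hk
      _ = lam ^ 2 * (g x * g y * (4 * Real.pi * ‖x - y‖)⁻¹) := by ring
  -- Step 3: the Coulomb energy of `g` is `8π∫gω` by the Newtonian representation of `ω`
  have hP : ∀ᵐ x : Space, ω x = (8 * Real.pi)⁻¹ * ∫ y, g y * ‖x - y‖⁻¹ := hω.ae_eq_potential hv hvi
  have hfinP := ae_lintegral_potential_lt_top hgm hgi hg0
  have step3 : ENNReal.ofReal 2⁻¹ * ∫⁻ x, ∫⁻ y, ENNReal.ofReal (g x * g y * (4 * Real.pi * ‖x - y‖)⁻¹) ≤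
      gOmegaIntegral v ω := by
    rw [← lintegral_const_mul' _ _ ENNReal.ofReal_ne_top]
    unfold gOmegaIntegral
    refine lintegral_mono_ae ?_
    filter_upwards [hP, hfinP] with x hx hfx
    -- the inner integral in real numbers
    have hint : Integrable fun y => g y * ‖x - y‖⁻¹ := by
      refine ⟨((hgm.comp measurable_id).mul ((measurable_const.sub measurable_id).norm.inv)).aestronglyMeasurable, ?_⟩
      rw [hasFiniteIntegral_iff_ofReal (Eventually.of_forall fun y =>
        mul_nonneg (hg0 y) (inv_nonneg.2 (norm_nonneg _)))]
      exact hfx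
    have h1 : ∫⁻ y, ENNReal.ofReal (g x * g y * (4 * Real.pi * ‖x - y‖)⁻¹) =
        ENNReal.ofReal (g x * (4 * Real.pi)⁻¹) * ENNReal.ofReal (∫ y, g y * ‖x - y‖⁻¹) := by
      rw [ofReal_integral_eq_lintegral_ofReal hint (Eventually.of_forall fun y =>
        mul_nonneg (hg0 y) (inv_nonneg.2 (norm_nonneg _))), ← lintegral_const_mul' _ _ ENNReal.ofReal_ne_top]
      refine lintegral_congr fun y => ?_
      rw [← ENNReal.ofReal_mul (mul_nonneg (hg0 x) (by positivity))]
      congr 1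
      rw [mul_inv]
      ring
    rw [h1, ← mul_assoc, ← ENNReal.ofReal_mul (by norm_num : (0 : ℝ) ≤ 2⁻¹),
      ← ENNReal.ofReal_mul (mul_nonneg (by norm_num) (mul_nonneg (hg0 x) (by positivity)))]
    refine le_trans (le_of_eq ?_) (ofReal_scatteringDensity_mul_le v ω x)
    congr 1
    have hgx : (v ‖x‖).toReal * (1 - ω x) * ω x = g x * ((8 * Real.pi)⁻¹ * ∫ y, g y * ‖x - y‖⁻¹) := by
      rw [← hx]
    rw [hgx]
    ring
  -- assembly
  calc ∫⁻ p : Space, ENNReal.ofReal (‖𝓕 (fun x : Space => ((bigW₁ v ω χ ℓ x).toReal : ℂ)) p‖ ^ 2 /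
        (8 * Real.pi ^ 2 * ‖p‖ ^ 2))
      = ENNReal.ofReal 2⁻¹ * ∫⁻ x, ∫⁻ y, ENNReal.ofReal (f x * f y * (4 * Real.pi * ‖x - y‖)⁻¹) := step1
    _ ≤ ENNReal.ofReal 2⁻¹ * (ENNReal.ofReal (lam ^ 2) *
          ∫⁻ x, ∫⁻ y, ENNReal.ofReal (g x * g y * (4 * Real.pi * ‖x - y‖)⁻¹)) := mul_le_mul_right step2 _
    _ = ENNReal.ofReal (lam ^ 2) * (ENNReal.ofReal 2⁻¹ *
          ∫⁻ x, ∫⁻ y, ENNReal.ofReal (g x * g y * (4 * Real.pi * ‖x - y‖)⁻¹)) := by ring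
    _ ≤ ENNReal.ofReal ((1 + 2 * C * (R / ℓ) ^ 2) ^ 2) * gOmegaIntegral v ω := mul_le_mul_right step3 _

end Literature.MathematicalPhysics.QuantumManyBody.BoseGas

end
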